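import Literature.Computability.Complexity.FKPointLocationProtocolValid
import Literature.Computability.Complexity.FournierKoiranTransferOracle
import Literature.Computability.Complexity.FKPointLocationUntyped
import HarnessLib

/-!
# Fournier–Koiran point location, non-uniform form: the protocol as a sign-query decision tree

Topic `Literature/Computability/Complexity`, grouping namespace `FKPointLocation`. The location
protocol of `FKPointLocationProtocol.lean` (Fournier–Koiran, ICALP 2000 = LIP RR-1999-21, §2,
after Meyer auf der Heide) asks two kinds of one-bit questions along the OBLIVIOUS schedule
`agenda Q`: sign questions about the input `x̂` and `NP` questions about its own state. In the
NON-UNIFORM setting (a linear decision tree = an oracle algorithm `OracleAlg` with an ARBITRARY step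
function talking to the sign oracle only, Meyer auf der Heide 1984/1988; Fournier–Koiran 1998,
"parameter-free" trees with small coefficients) the `NP` questions cost nothing: the step function
answers them itself. This file renders that remark:

* `replay` — the state of the protocol reconstructed from the list of answer bits received so far
  (sign tasks read their bit, `NP` tasks are decided in place), `replay_ansUpTo` (with truthful
  sign bits the replayed state is the truthful run);
* `treeAlg Q finT out enc` — the oracle algorithm: query the code `enc (queryForm dat τ)` of the
  form of the next task, output `out dat` after the last one;
* `treeAlg_run` — against any oracle answering the code of a form `φ` by the bit `[0 ≤ φ(x̂)]`, the
  run with budget `|agenda| + 1` outputs `out (finalData Q finT x̂)` (so, with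
  `FKPointLocationProtocolValid.finalData_valid`, a function of a VALID location certificate);
* `mem_queries_treeAlg` — every query asked (with any budget) is the code of the form of some task
  of the schedule at a state of the truthful run (the hook for the size bounds of
  `FKPointLocationFormBounds.lean`);
* `encHat n φ` — the sign query (`AdditiveRealClasses.signOracle` format: the `listBool` code of
  `[c, a₀, …, a_{n-1}]`) of the affine form `φ` of `ℝ^{n+1}` read on the homogenised input `x̂ = (x, 1)`,
  `signOracle_encHat` (it is answered by the bit `[0 ≤ φ(x̂)]`), `length_encHat_le` (its length under
  a coefficient bound).

## References

* H. Fournier, P. Koiran, *Lower bounds are not easier over the reals: inside PH*, ICALP 2000,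
  LNCS 1853 = LIP RR-1999-21, §2 (Thm 2; the `NP` oracle is only consulted on Boolean data computed
  from earlier answers). [FournierKoiran2000]
* H. Fournier, P. Koiran, *Are lower bounds easier over the reals?*, STOC 1998, 507–513 (polynomial
  depth parameter-free linear decision trees from Meyer auf der Heide's construction). [FournierKoiran1998]
* F. Meyer auf der Heide, *A polynomial linear search algorithm for the n-dimensional knapsack
  problem*, J. ACM 31 (1984) 668–676; *Fast algorithms for n-dimensional restrictions of hard
  problems*, J. ACM 35 (1988) 740–747. [Meyeraufderheide1984] [MeyerAufDerHeide1988]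
-/

namespace Literature.Computability.Complexity

namespace FKPointLocation

open _root_.Computability Finset

variable (Q : LevelParams) (finT : Cert Q.D → Prop)

/-! ### Replaying the protocol from the answer bits -/

open Classical in
/-- The bit an `NP` task receives in the non-uniform rendering: its own truth value, computed by
the step function. [cite: FournierKoiran2000, §2.1 (the conditions are checked "with a boolean NP algorithm")] -/
noncomputable def npBit (dat : Data Q.D) (τ : Task Q.D) : Bool := decide (npTruth finT (certOf Q) dat τ)

/-- One replayed step on the pair (task, received bit): a sign task is updated with the received
bit, an `NP` task with its self-computed truth value. [cite: FournierKoiran2000, §2.1] -/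
noncomputable def replayStep (dat : Data Q.D) (p : Task Q.D × Bool) : Data Q.D :=
  upd Q dat p.1 (if p.1.isSign then p.2 else npBit Q finT dat p.1)

/-- The state after replaying the tasks `ts` on the bits `bs`, from `dat` (one step per bit, at
most `|ts|` steps). [cite: FournierKoiran2000, §2.1] -/
noncomputable def replay : Data Q.D → List (Task Q.D) → List Bool → Data Q.D
  | dat, _, [] => dat
  | dat, [], _ :: _ => dat
  | dat, τ :: ts, b :: bs => replay (replayStep Q finT dat (τ, b)) ts bs

variable {Q finT}

/-- For an `NP` task the truthful answer is the self-computed bit. [folklore] -/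
theorem truth_of_isSign_eq_false {xh : Fin Q.D → ℝ} {dat : Data Q.D} {τ : Task Q.D} (h : τ.isSign = false) :
    truth finT (certOf Q) xh dat τ = npBit Q finT dat τ := by
  unfold truth npBit
  rw [h]
  simp only [Bool.false_eq_true, ↓reduceIte]

/-- For a sign task the truthful answer is the sign bit of the queried form. [folklore] -/
theorem truth_of_isSign_eq_true {xh : Fin Q.D → ℝ} {dat : Data Q.D} {τ : Task Q.D} (h : τ.isSign = true) :
    truth finT (certOf Q) xh dat τ = decide (0 ≤ aff (queryForm dat τ) xh) := by
  unfold truth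
  rw [h]
  simp only [↓reduceIte]

/-- A replayed step with a truthful sign bit is the truthful step. [folklore] -/
theorem replayStep_eq_step {xh : Fin Q.D → ℝ} (dat : Data Q.D) (τ : Task Q.D) (b : Bool)
    (hb : τ.isSign = true → b = decide (0 ≤ aff (queryForm dat τ) xh)) :
    replayStep Q finT dat (τ, b) = step Q finT xh dat τ := by
  unfold replayStep step
  cases hs : τ.isSign
  · rw [truth_of_isSign_eq_false hs]; simp
  · rw [truth_of_isSign_eq_true hs, hb hs]; simp

/-- `replay` on one more (task, bit) pair. [folklore] -/
@[simp] theorem replay_cons_cons (dat : Data Q.D) (τ : Task Q.D) (ts : List (Task Q.D)) (b : Bool) (bs : List Bool) :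
    replay Q finT dat (τ :: ts) (b :: bs) = replay Q finT (replayStep Q finT dat (τ, b)) ts bs := rfl

/-- `replay` with no bits left. [folklore] -/
@[simp] theorem replay_nil_bits (dat : Data Q.D) (ts : List (Task Q.D)) : replay Q finT dat ts [] = dat := by
  cases ts <;> rfl

/-- `replay` with no tasks left. [folklore] -/
@[simp] theorem replay_nil_tasks (dat : Data Q.D) (bs : List Bool) : replay Q finT dat [] bs = dat := by
  cases bs <;> rfl

/-- **One more bit**: replaying `bs ++ [b]` is one replayed step, on the task of index `|bs|`, after
replaying `bs`. [folklore] -/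
theorem replay_append_singleton :
    ∀ (dat : Data Q.D) (ts : List (Task Q.D)) (bs : List Bool) (b : Bool) (h : bs.length < ts.length),
      replay Q finT dat ts (bs ++ [b]) = replayStep Q finT (replay Q finT dat ts bs) (ts[bs.length], b)
  | dat, [], bs, b, h => by simp at h
  | dat, τ :: ts, [], b, _ => by simp
  | dat, τ :: ts, b₀ :: bs, b, h => by
    simp only [List.cons_append, replay_cons_cons, List.length_cons, List.getElem_cons_succ]
    exact replay_append_singleton _ ts bs b (by simpa using h)

/-! ### The truthful run, state by state -/

section States

variable (Q finT) (xh : Fin Q.D → ℝ)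

/-- The state of the truthful run after the first `s` tasks of the schedule. [cite: FournierKoiran2000, §2.1] -/
noncomputable def stateAt (s : ℕ) : Data Q.D := runFrom Q finT xh (Data.init Q.D) ((agenda Q).take s)

/-- The `s`-th task of the schedule (junk `close` beyond the end). [folklore] -/
def taskAt (s : ℕ) : Task Q.D := ((agenda Q)[s]?).getD Task.close

/-- The form queried at step `s` of the truthful run. [cite: FournierKoiran2000, §2.1] -/
noncomputable def formAt (s : ℕ) : AffForm Q.D := queryForm (stateAt Q finT xh s) (taskAt Q s)

variable {Q finT xh}

/-- `stateAt 0` is the initial state. [folklore] -/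
@[simp] theorem stateAt_zero : stateAt Q finT xh 0 = Data.init Q.D := by simp [stateAt, runFrom]

/-- One more task of the schedule. [folklore] -/
theorem stateAt_succ {s : ℕ} (hs : s < (agenda Q).length) :
    stateAt Q finT xh (s + 1) = step Q finT xh (stateAt Q finT xh s) (taskAt Q s) := by
  simp only [stateAt, taskAt]
  rw [List.take_succ_eq_append_getElem hs, runFrom_append, List.getElem?_eq_getElem hs]
  rfl

/-- Beyond the schedule the state is final. [folklore] -/
theorem stateAt_of_le {s : ℕ} (hs : (agenda Q).length ≤ s) : stateAt Q finT xh s = finalData Q finT xh := by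
  simp only [stateAt, finalData, List.take_of_length_le hs]

end States

/-! ### The decision tree -/

section Tree

variable (Q finT)

/-- **The location protocol as a sign-query oracle algorithm** (non-uniform: the step function is
arbitrary). On the answers received so far it replays the protocol, then either queries the code
`enc` of the form of the next task of the schedule or, after the last task, outputs `out` of the
final state. [cite: FournierKoiran2000, Thm 2 (report p. 4: location), here without the `NP` oracle; after MeyerAufDerHeide1988] -/
noncomputable def treeAlg (out : Data Q.D → Bool) (enc : AffForm Q.D → List Bool) : OracleAlg Bool where
  step _ answers :=
    match (agenda Q)[answers.length]? with
    | some τ => Sum.inl (enc (queryForm (replay Q finT (Data.init Q.D) (agenda Q) (answers.map decodeBool)) τ))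
    | none => Sum.inr (out (replay Q finT (Data.init Q.D) (agenda Q) (answers.map decodeBool)))

variable {Q finT}
variable {out : Data Q.D → Bool} {enc : AffForm Q.D → List Bool} {O : Oracle} {xh : Fin Q.D → ℝ}

/-- The canonical transcript: the answers of `O` to the forms of the truthful run, steps `< t`.
[folklore] -/
noncomputable def ansUpTo (Q : LevelParams) (finT : Cert Q.D → Prop) (enc : AffForm Q.D → List Bool) (O : Oracle)
    (xh : Fin Q.D → ℝ) (t : ℕ) : List (List Bool) :=
  (List.range t).map fun s => O (enc (formAt Q finT xh s))

/-- Length of the canonical transcript. [folklore] -/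
@[simp] theorem length_ansUpTo (t : ℕ) : (ansUpTo Q finT enc O xh t).length = t := by simp [ansUpTo]

/-- The canonical transcript grows by one answer. [folklore] -/
theorem ansUpTo_succ (t : ℕ) :
    ansUpTo Q finT enc O xh (t + 1) = ansUpTo Q finT enc O xh t ++ [O (enc (formAt Q finT xh t))] := by
  simp [ansUpTo, List.range_succ]

/-- **Replaying truthful bits gives the truthful run.** If `O` answers the code of every form by
its sign bit at `x̂`, then replaying the first `t ≤ |agenda|` decoded answers of the canonical
transcript yields `stateAt t`. [cite: FournierKoiran2000, §2.1] -/
theorem replay_ansUpTo (hO : ∀ φ : AffForm Q.D, O (enc φ) = encodeBool (decide (0 ≤ aff φ xh))) :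
    ∀ t, t ≤ (agenda Q).length →
      replay Q finT (Data.init Q.D) (agenda Q) ((ansUpTo Q finT enc O xh t).map decodeBool) = stateAt Q finT xh t
  | 0, _ => by simp [ansUpTo]
  | t + 1, ht => by
    have ht' : t < (agenda Q).length := ht
    have ih := replay_ansUpTo hO t ht'.le
    rw [ansUpTo_succ, List.map_append, List.map_singleton, hO, decode_encodeBool,
      replay_append_singleton _ _ _ _ (by simpa using ht'), ih, stateAt_succ ht']
    have hτ : (agenda Q)[((ansUpTo Q finT enc O xh t).map decodeBool).length]'(by simpa using ht') = taskAt Q t := by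
      simp only [taskAt, List.length_map, length_ansUpTo, List.getElem?_eq_getElem ht', Option.getD_some]
    rw [hτ]
    exact replayStep_eq_step _ _ _ fun _ => rfl

/-- The step function of `treeAlg` on the canonical transcript of length `t < |agenda|`: query the
form of step `t`. [folklore] -/
theorem treeAlg_step_of_lt (hO : ∀ φ : AffForm Q.D, O (enc φ) = encodeBool (decide (0 ≤ aff φ xh)))
    (inp : List Bool) {t : ℕ} (ht : t < (agenda Q).length) :
    (treeAlg Q finT out enc).step inp (ansUpTo Q finT enc O xh t) = Sum.inl (enc (formAt Q finT xh t)) := by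
  simp only [treeAlg, length_ansUpTo, List.getElem?_eq_getElem ht, replay_ansUpTo hO t ht.le, formAt, taskAt,
    Option.getD_some]

/-- The step function of `treeAlg` on the full canonical transcript: output. [folklore] -/
theorem treeAlg_step_of_eq (hO : ∀ φ : AffForm Q.D, O (enc φ) = encodeBool (decide (0 ≤ aff φ xh)))
    (inp : List Bool) :
    (treeAlg Q finT out enc).step inp (ansUpTo Q finT enc O xh (agenda Q).length) =
      Sum.inr (out (finalData Q finT xh)) := by
  simp only [treeAlg, length_ansUpTo, List.getElem?_eq_none (le_refl _), replay_ansUpTo hO _ le_rfl,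
    stateAt_of_le le_rfl]

/-- The fuelled run from the canonical transcript of length `t` with `|agenda| - t + 1` rounds left.
[folklore] -/
theorem treeAlg_runAux (hO : ∀ φ : AffForm Q.D, O (enc φ) = encodeBool (decide (0 ≤ aff φ xh)))
    (inp : List Bool) :
    ∀ m t, t + m = (agenda Q).length →
      (treeAlg Q finT out enc).runAux O inp (m + 1) (ansUpTo Q finT enc O xh t) = some (out (finalData Q finT xh))
  | 0, t, h => by
    rw [OracleAlg.runAux_succ, show t = (agenda Q).length by omega, treeAlg_step_of_eq hO]
  | m + 1, t, h => by
    rw [OracleAlg.runAux_succ, treeAlg_step_of_lt hO inp (by omega : t < (agenda Q).length)]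
    simp only
    rw [← ansUpTo_succ]
    exact treeAlg_runAux hO inp m (t + 1) (by omega)

/-- **The run of the decision tree.** Against an oracle answering the code of every form by its sign
bit at `x̂`, within `|agenda| + 1` rounds (and hence within any larger budget) the tree outputs
`out (finalData Q finT x̂)`. [cite: FournierKoiran2000, Thm 2 (report p. 4)] -/
theorem treeAlg_run (hO : ∀ φ : AffForm Q.D, O (enc φ) = encodeBool (decide (0 ≤ aff φ xh)))
    (inp : List Bool) {k : ℕ} (hk : (agenda Q).length + 1 ≤ k) :
    (treeAlg Q finT out enc).run O k inp = some (out (finalData Q finT xh)) :=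
  OracleAlg.run_mono _ O inp hk (treeAlg_runAux hO inp (agenda Q).length 0 (by omega))

/-- The queries from the canonical transcript of length `t` onwards, with any fuel, are codes of
forms of the truthful run. [folklore] -/
theorem mem_queriesAux_treeAlg (hO : ∀ φ : AffForm Q.D, O (enc φ) = encodeBool (decide (0 ≤ aff φ xh)))
    (inp : List Bool) :
    ∀ (k t : ℕ), t ≤ (agenda Q).length →
      ∀ y ∈ (treeAlg Q finT out enc).queriesAux O inp k (ansUpTo Q finT enc O xh t),
        ∃ s < (agenda Q).length, y = enc (formAt Q finT xh s)
  | 0, t, _, y, hy => by simp at hy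
  | k + 1, t, ht, y, hy => by
    unfold OracleAlg.queriesAux at hy
    rcases ht.lt_or_eq with hlt | rfl
    · rw [treeAlg_step_of_lt hO inp hlt] at hy
      simp only [List.mem_cons] at hy
      rcases hy with rfl | hy
      · exact ⟨t, hlt, rfl⟩
      · rw [← ansUpTo_succ] at hy
        exact mem_queriesAux_treeAlg hO inp k (t + 1) hlt y hy
    · rw [treeAlg_step_of_eq hO inp] at hy
      simp at hy

/-- **Every query of the decision tree is the code of a form of the truthful run** (for any round
budget). [cite: FournierKoiran2000, §2.2 (the sizes of the tests)] -/
theorem mem_queries_treeAlg (hO : ∀ φ : AffForm Q.D, O (enc φ) = encodeBool (decide (0 ≤ aff φ xh)))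
    (inp : List Bool) (k : ℕ) {y : List Bool} (hy : y ∈ (treeAlg Q finT out enc).queries O k inp) :
    ∃ s < (agenda Q).length, y = enc (formAt Q finT xh s) :=
  mem_queriesAux_treeAlg hO inp k 0 (Nat.zero_le _) y hy

end Tree

/-! ### The code of a form on the homogenised input -/

section Code

variable {n : ℕ}

/-- The integer list `[c + a_n, a_0, …, a_{n-1}]` of the affine form `φ = (a, c)` of `ℝ^{n+1}` read on
`x̂ = (x, 1)`. [cite: FournierKoiran2000, §2.3 (setting `x_{n+1} = 1`)] -/
def hatList (n : ℕ) (φ : AffForm (n + 1)) : List ℤ :=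
  (φ.2 + φ.1 (Fin.last n)) :: List.ofFn fun i : Fin n => φ.1 i.castSucc

/-- **The sign query of a form on the homogenised input**: the `listBool` code of `hatList`.
[cite: FournierKoiran2000, §2 Remark 1 and §2.3] -/
def encHat (n : ℕ) (φ : AffForm (n + 1)) : List Bool := (encodingIntBool.listBool).encode (hatList n φ)

/-- The value of `φ` at `x̂` is `(c + a_n) + ∑_{i<n} aᵢ xᵢ`. [cite: FournierKoiran2000, §2.3] -/
theorem aff_hat (φ : AffForm (n + 1)) (x : Fin n → ℝ) :
    aff φ (hat x) = ((φ.2 + φ.1 (Fin.last n) : ℤ) : ℝ) + ∑ i : Fin n, (φ.1 i.castSucc : ℝ) * x i := by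
  simp only [aff, lin, hat, Fin.sum_univ_castSucc, Fin.snoc_castSucc, Fin.snoc_last, mul_one, Int.cast_add]
  ring

/-- **The sign oracle answers `encHat n φ` by the sign bit of `φ` at `x̂`.** [cite: FournierKoiran2000, §2 Remark 1] -/
theorem signOracle_encHat (x : Fin n → ℝ) (φ : AffForm (n + 1)) :
    signOracle x (encHat n φ) = encodeBool (decide (0 ≤ aff φ (hat x))) := by
  rw [encHat, signOracle_apply, affineQueryValue_encode, aff_hat]
  congr 2
  simp only [hatList, List.getD_cons_zero, List.getD_cons_succ, getD_ofFn]

/-! ### Length of the code -/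

/-- `|encodePosNum p|` is the number of binary digits of `p` (private copy). [folklore] -/
private theorem length_encodePosNum' (p : PosNum) : (encodePosNum p).length = p.natSize := by
  induction p with
  | one => rfl
  | bit0 p ih => simp only [encodePosNum, List.length_cons, ih, PosNum.natSize]
  | bit1 p ih => simp only [encodePosNum, List.length_cons, ih, PosNum.natSize]

/-- `|encodeNat m| = Nat.size m` (private copy of `TM2Pass.length_encodeNat_eq_size`). [folklore] -/
private theorem length_encodeNat_eq_size' (m : ℕ) : (encodeNat m).length = m.size := by
  have h : ((m : Num) : ℕ) = m := Num.to_of_nat m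
  unfold encodeNat encodeNum
  cases hm : (m : Num) with
  | zero =>
    rw [hm, Num.cast_zero'] at h
    subst h
    rfl
  | pos p =>
    rw [hm, Num.cast_pos] at h
    rw [← h, length_encodePosNum', ← PosNum.size_eq_natSize, PosNum.size_to_nat]

/-- An integer of absolute value `≤ 2^G` has a code of length `≤ G + 5`. [folklore] -/
theorem length_encodingIntBool_le {z : ℤ} {G : ℕ} (hz : z.natAbs ≤ 2 ^ G) : (encodingIntBool.encode z).length ≤ G + 5 := by
  change (boolPair (encodeBool (decide (z < 0))) (encodeNat z.natAbs)).length ≤ G + 5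
  rw [length_boolPair, length_encodeNat_eq_size']
  have : z.natAbs.size ≤ G + 1 := by
    rw [Nat.size_le]
    exact lt_of_le_of_lt hz (Nat.pow_lt_pow_right (by norm_num) (Nat.lt_succ_self G))
  have h1 : (encodeBool (decide (z < 0))).length = 1 := rfl
  omega

/-- Length of a `listBool` code of bounded integers. [folklore] -/
theorem length_listBool_encode_int_le {G : ℕ} :
    ∀ (l : List ℤ), (∀ z ∈ l, z.natAbs ≤ 2 ^ G) →
      ((encodingIntBool.listBool).encode l).length ≤ 2 * l.length + 2 + l.length * (2 * (G + 5) + 2) := by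
  have H : ∀ l : List ℤ, (∀ z ∈ l, z.natAbs ≤ 2 ^ G) →
      (l.foldr (fun a acc => boolPair (encodingIntBool.encode a) acc) []).length ≤ l.length * (2 * (G + 5) + 2) := by
    intro l hl
    induction l with
    | nil => simp
    | cons a l ih =>
      simp only [List.foldr_cons, length_boolPair, List.length_cons]
      have ha := length_encodingIntBool_le (hl a (by simp))
      have := ih (fun z hz => hl z (by simp [hz]))
      nlinarith
  intro l hl
  change (boolPair (unaryEncodeNat l.length) (l.foldr (fun a acc => boolPair (encodingIntBool.encode a) acc) [])).length ≤ _
  rw [length_boolPair, length_unaryEncodeNat']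
  have := H l hl
  omega

/-- **Length of the query of a bounded form**: coefficients and constant `≤ 2^F` in absolute value give
`|encHat n φ| ≤ 2(n+1) + 2 + (n+1)(2F + 14)`. [cite: FournierKoiran2000, §2.2] -/
theorem length_encHat_le {F : ℕ} {φ : AffForm (n + 1)} (hφ1 : ∀ k, (φ.1 k).natAbs ≤ 2 ^ F) (hφ2 : φ.2.natAbs ≤ 2 ^ F) :
    (encHat n φ).length ≤ 2 * (n + 1) + 2 + (n + 1) * (2 * (F + 1 + 5) + 2) := by
  have hlen : (hatList n φ).length = n + 1 := by simp [hatList]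
  have hb : ∀ z ∈ hatList n φ, z.natAbs ≤ 2 ^ (F + 1) := by
    intro z hz
    simp only [hatList, List.mem_cons, List.mem_ofFn] at hz
    rcases hz with rfl | ⟨i, rfl⟩
    · calc _ ≤ φ.2.natAbs + (φ.1 (Fin.last n)).natAbs := Int.natAbs_add_le _ _
        _ ≤ 2 ^ F + 2 ^ F := Nat.add_le_add hφ2 (hφ1 _)
        _ = 2 ^ (F + 1) := by ring
    · exact (hφ1 _).trans (Nat.pow_le_pow_right (by norm_num) (Nat.le_succ F))
  have := length_listBool_encode_int_le (hatList n φ) hb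
  rw [hlen] at this
  exact this

end Code

end FKPointLocation

end Literature.Computability.Complexity
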